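import Literature.MathematicalPhysics.QuantumFieldTheory.Balaban1983to89.B11SectG
import Literature.MathematicalPhysics.QuantumFieldTheory.Balaban1983to89.B9Thm34Ext
import Literature.MathematicalPhysics.QuantumFieldTheory.Balaban1983to89.B9Thm37AllNormsRight

/-!
# `Balaban1983to89.B9SectBRatioComp` — [B9] Sect. B ∕ Theorem 3.4 in OTHER NORMS, the located input of the Neumann series:
# the operator V = G′(U)V′(A) of (3.62) has a CONJUGATED («ratio») majorant θ·(W(y)∕W(y′))·e^{−ρd(y,y′)}, W = (L^jη)², in ANY
# block norm, from the member of G′(U) in that norm, the zeroth∕first-order sizes (3.61) of V′(A) in divergence form, the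
# comparability of block scales along the distance, and Lemma 2.1 of [4] (cell `pub-ymgap`, Track A node N06 [B9] -b item 2b of
# `HANDOFF-dag-n06-b.md` §4, dag-lead REBALANCE-24; seat dag-n19-b; count-neutral MODEL bookkeeping, generic layer)

References (bib keys): [B9] = `Balaban1985BackgroundPropagators` — T. Bałaban, *Propagators for lattice gauge theories in a
background field*, Commun. Math. Phys. 99 (1985) 389–434; [4] = `Balaban1984PropagatorsII` — T. Bałaban, *Propagators and
renormalization transformations for lattice gauge theories. II*, Commun. Math. Phys. 96 (1984) 223–250.

THE PRINTED LOCI (only NAMED; certified in the headers of `B9Thm37AllNormsRight` (dag-n06-b), `B9Eq360VprimeLetters` (r06),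
`B11SectG`): [B9] p. 402 (3.60)–(3.64): «Δ_{U′U} + Q′*(U′U)aQ′(U′U) = Δ_U + Q′*(U)aQ′(U) − V′(A) (3.60) … |(V′(A)λ)(x)| ≦
O(1)α₁((Lʲη)⁻¹|∇_Uλ| + (Lʲη)⁻²|λ|) (3.61)», the resolvent expansion G′(U′U) = Σₙ (G′(U)V′(A))ⁿG′(U) ((3.62)–(3.64)) and
p. 398 (remark: «we may replace the factor (L^jη)^α by (L^jη)^β(L^{j′}η)^γ with β + γ = α», Lemma 2.1 of [4]); [4] (2.52)–(2.55)
p. 232 (composition of block majorants), Lemma 2.1 (2.61) p. 234, (2.2) p. 224 (the nested domains: scales change slowly with the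
distance).  NOTHING printed is asserted.

THE POINT.  `B9Thm37AllNormsRight.neumann_left_weighted` (dag-n06-b) sums A₀ = S + VA₀ over ARBITRARY block norms once V has the
conjugated majorant `θ·(W y∕W y′)·e^{−δ₀d}` (`hV`).  For Sect. B, V = G′(U)V′(A) with V′(A) = C₀ + Σ_k ∇*_kC_k in divergence form
(zeroth-order part |C₀| ≲ α₁(Lʲη)⁻², first-order coefficients |C_k| ≲ α₁(Lʲη)⁻¹ — (3.61)∕(3.73), r06's `B9Eq360VprimeLetters`), so
G′V′ = G′C₀ + Σ_k (G′∇*_k)C_k uses the members (3.42)₁ (weight (Lʲη)²) and (3.42)₃ (weight Lʲη) of G′(U).  This file is the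
GENERIC composition, norm-agnostic (`B11SectG.HasMaj` between `BlockNorm`s):
 * §1 scale-transfer algebra for a weight U > 0 with `U x ≤ C_U·e^{εd(x,y)}·U y` (the model of [4] (2.2): block scales of
   neighbouring blocks are comparable, and change by at most a factor e^{εd} along the distance);
 * §2 **`hasMaj_comp_ratio`**: T₁ (majorant A₁U(y)e^{−ρ₁d}) after T₂ (majorant A₂U(y)⁻¹e^{−ρ₂d}) has the RATIO majorant
   κ₂A₁A₂C_Uc·(U y∕U y′)·e^{−ρd} (ρ + ε ≤ ρ₂, ρ + σ ≤ ρ₁, Lemma 2.1 row sum c at rate σ, symmetric distance);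
 * §3 `HasMaj.ratio_sq`: a U-ratio majorant is a U²-ratio majorant at the cost C_U and ε in the rate (p. 398 remark);
 * §5 `hasMaj_ratio_sectB_sup`: the same read at the sharp-block sup sizes with `B6RandomWalk.HasMajorant` hypotheses (the native
   vocabulary of the (3.42) members and of r06's V′-letters), κ = 1.
 * §6 **`thm34_member_of_ratio`**: Theorem 3.4's (Lʲη)²-member of G′(U′U) in the norm `b` — §4's `hV` fed to dag-n06-b's
   `neumann_left_weighted` BY NAME (W = (Lʲη)², Q = 1): `G′(U′U) ≺ B₀c₁(α)(1 − κθc₁(α))⁻¹(Lʲη)²e^{−(1−α)δ₀d}`.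
 * §4 **`hasMaj_ratio_sectB`**: V = G′∘C₀ + Σ_{k∈s}(G′∇*_k)∘C_k ⇒ `HasMaj b b V (θ·((Lʲη)²(y)∕(Lʲη)²(y′))·e^{−ρd})` with
   θ = B₀·c·C_ℓ²·(κ·c₀ + #s·κ_Y·c₁) EXPLICIT — the `hV` of `neumann_left_weighted` with W = (Lʲη)².

HONEST SCOPE.  Generic layer only: the members of G′(U) ((3.42)∕(3.46), Theorems 3.1–3.3), the letter sizes of V′(A) IN THE CHOSEN
NORM and the divergence-form identity are HYPOTHESES (for the sharp-block sup sizes r06's `B9Eq360VprimeLetters.hasMajorant_divForm_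
zeroth_vPrime` and gen-8 letters supply them via `B11SectG.hasMaj_of_hasMajorant`; block-L² ∕ Hölder-probe versions of the letters are
NOT in the tree); the scale transfer `hℓ` is the model of (2.2), not derived from a concrete geometry here.  Value = MODEL kernel
bookkeeping, NOT summit progress; NOT continuum, NOT Clay, NOT a claim about print.
-/

namespace Literature.MathematicalPhysics.QuantumFieldTheory.Balaban1983to89.B9SectBRatioComp

open Literature.MathematicalPhysics.QuantumFieldTheory.Balaban1983to89
open Finset B6RandomWalk B11SectG

noncomputable section

variable {g : B6.Geometry}
variable {F₁ F₂ F₃ : Type} [AddCommGroup F₁] [Module ℝ F₁] [AddCommGroup F₂] [Module ℝ F₂]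
  [AddCommGroup F₃] [Module ℝ F₃]

/-! ## §1  Scale-transfer algebra -/

section Transfer

/-- The printed scale-transfer shape (`B9Ineq347.ScaleTransfer`, p. 398: `e^{−εd(y,y′)}·U(y′) ≤ C_U·U(y)`, stated there for a
`B9.Geometry`) read on the block geometry of `B11SectG` with a symmetric distance gives the multiplicative form used below:
`U(x) ≤ C_U·e^{εd(x,y)}·U(y)`. [cite: Balaban1985BackgroundPropagators, p.398 (remark)] -/
theorem transfer_of_scaleTransfer (U : g.Site → ℝ) {CU ε : ℝ} (hsymm : ∀ a b : g.Site, g.dist a b = g.dist b a)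
    (hST : ∀ y y' : g.Site, Real.exp (-(ε * g.dist y y')) * U y' ≤ CU * U y) (x y : g.Site) :
    U x ≤ CU * Real.exp (ε * g.dist x y) * U y := by
  have h := hST y x
  have hexp : 0 < Real.exp (ε * g.dist x y) := Real.exp_pos _
  have hmul := mul_le_mul_of_nonneg_left h hexp.le
  rw [← mul_assoc, hsymm y x, ← Real.exp_add] at hmul
  have hz : ε * g.dist x y + -(ε * g.dist x y) = 0 := by ring
  rw [hz, Real.exp_zero, one_mul] at hmul
  calc U x ≤ Real.exp (ε * g.dist x y) * (CU * U y) := hmul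
    _ = CU * Real.exp (ε * g.dist x y) * U y := by ring

/-- Scale transfer read for the reciprocal weight: `U(y)⁻¹ ≤ C_U·e^{εd(b,y)}·U(b)⁻¹`. [cite: Balaban1984PropagatorsII, (2.2) p.224] -/
theorem inv_le_of_transfer (U : g.Site → ℝ) {CU ε : ℝ} (hU0 : ∀ y, 0 < U y)
    (hU : ∀ x y, U x ≤ CU * Real.exp (ε * g.dist x y) * U y) (y b : g.Site) :
    (U y)⁻¹ ≤ CU * Real.exp (ε * g.dist b y) * (U b)⁻¹ := by
  have hb := hU0 b
  have hy := hU0 y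
  rw [inv_eq_one_div, inv_eq_one_div, mul_one_div, div_le_div_iff₀ hy hb, one_mul]
  exact hU b y

/-- A U-ratio is a U²-ratio up to the transfer factor: `U a∕U b ≤ C_U·e^{εd(b,a)}·(U a∕U b)²`. [cite: Balaban1985BackgroundPropagators, p.398 (remark)] -/
theorem ratio_le_transfer_sq (U : g.Site → ℝ) {CU ε : ℝ} (hU0 : ∀ y, 0 < U y)
    (hU : ∀ x y, U x ≤ CU * Real.exp (ε * g.dist x y) * U y) (a b : g.Site) :
    U a / U b ≤ CU * Real.exp (ε * g.dist b a) * (U a / U b) ^ 2 := by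
  have ha := hU0 a
  have hb := hU0 b
  have hba : U b / U a ≤ CU * Real.exp (ε * g.dist b a) := by
    rw [div_le_iff₀ ha]
    exact hU b a
  have hpos : 0 < U a / U b := div_pos ha hb
  calc U a / U b = (U b / U a) * (U a / U b) ^ 2 := by
        field_simp
    _ ≤ CU * Real.exp (ε * g.dist b a) * (U a / U b) ^ 2 :=
        mul_le_mul_of_nonneg_right hba (sq_nonneg _)

/-- Squaring the scale transfer: `U(x)² ≤ C_U²·e^{2εd(x,y)}·U(y)²`. [cite: Balaban1984PropagatorsII, (2.2) p.224] -/
theorem transfer_sq (U : g.Site → ℝ) {CU ε : ℝ} (hU0 : ∀ y, 0 < U y) (hCU : 0 ≤ CU)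
    (hU : ∀ x y, U x ≤ CU * Real.exp (ε * g.dist x y) * U y) (x y : g.Site) :
    U x ^ 2 ≤ CU ^ 2 * Real.exp (2 * ε * g.dist x y) * U y ^ 2 := by
  have h := hU x y
  have h0 : 0 ≤ U x := (hU0 x).le
  have hrhs : 0 ≤ CU * Real.exp (ε * g.dist x y) * U y := by
    have := (hU0 y).le
    positivity
  calc U x ^ 2 ≤ (CU * Real.exp (ε * g.dist x y) * U y) ^ 2 := pow_le_pow_left₀ h0 h 2
    _ = CU ^ 2 * (Real.exp (ε * g.dist x y) * Real.exp (ε * g.dist x y)) * U y ^ 2 := by ring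
    _ = CU ^ 2 * Real.exp (2 * ε * g.dist x y) * U y ^ 2 := by rw [← Real.exp_add]; ring_nf

end Transfer

/-! ## §2  Composition to the ratio form -/

section Comp

/-- **COMPOSITION TO THE CONJUGATED («RATIO») MAJORANT.**  If T₁ : F₂ → F₃ has the majorant `A₁·U(y)·e^{−ρ₁d(y,y″)}` (a member
of G′(U) carrying the output power U = (Lʲη)^β) and T₂ : F₁ → F₂ the majorant `A₂·U(y″)⁻¹·e^{−ρ₂d(y″,y′)}` (a coefficient of V′(A)
carrying the inverse power), the weight U transfers along the distance (`hU`), the distance is symmetric and Lemma 2.1's row sum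
holds at rate σ with constant c, then T₁T₂ has the majorant `κ₂·A₁·A₂·C_U·c·(U y∕U y′)·e^{−ρd(y,y′)}` for every `ρ ≥ 0` with
`ρ + ε ≤ ρ₂`, `ρ + σ ≤ ρ₁`. [cite: Balaban1985BackgroundPropagators, (3.62)–(3.64) p.402 + p.398 (remark); Balaban1984PropagatorsII, (2.52)–(2.55) p.232 + Lemma 2.1 (2.61) p.234] -/
theorem hasMaj_comp_ratio {b₁ : BlockNorm g F₁} {b₂ : BlockNorm g F₂} {b₃ : BlockNorm g F₃}
    {T₁ : F₂ →ₗ[ℝ] F₃} {T₂ : F₁ →ₗ[ℝ] F₂} (U : g.Site → ℝ) {A₁ A₂ CU ε ρ₁ ρ₂ ρ σ c : ℝ}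
    (htri : Triangle254 g) (hd : ∀ a b : g.Site, 0 ≤ g.dist a b) (hsymm : ∀ a b : g.Site, g.dist a b = g.dist b a)
    (hrow : RowSum g σ c) (hA₁ : 0 ≤ A₁) (hA₂ : 0 ≤ A₂) (hCU : 0 ≤ CU) (hU0 : ∀ y, 0 < U y)
    (hU : ∀ x y, U x ≤ CU * Real.exp (ε * g.dist x y) * U y)
    (hρ : 0 ≤ ρ) (hρ₂ : ρ + ε ≤ ρ₂) (hρ₁ : ρ + σ ≤ ρ₁)
    (h₁ : HasMaj b₂ b₃ T₁ (fun a y => A₁ * U a * Real.exp (-(ρ₁ * g.dist a y))))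
    (h₂ : HasMaj b₁ b₂ T₂ (fun y b => A₂ * (U y)⁻¹ * Real.exp (-(ρ₂ * g.dist y b)))) :
    HasMaj b₁ b₃ (T₁ ∘ₗ T₂)
      (fun a b => b₂.κ * A₁ * A₂ * CU * c * (U a / U b) * Real.exp (-(ρ * g.dist a b))) := by
  refine (hasMaj_comp h₁ h₂ fun a y =>
    mul_nonneg (mul_nonneg hA₁ (hU0 a).le) (Real.exp_nonneg _)).mono fun a b => ?_
  have hconv := conv_exp_le (ρ₂ := ρ₂ - ε) htri hd hrow hρ (by linarith) hρ₁ a b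
  -- termwise: replace U(y″)⁻¹ by C_U e^{ε d(y″,b)} U(b)⁻¹
  have hterm : ∀ y'' : g.Site,
      A₁ * U a * Real.exp (-(ρ₁ * g.dist a y'')) * (b₂.κ * (A₂ * (U y'')⁻¹ * Real.exp (-(ρ₂ * g.dist y'' b)))) ≤
        b₂.κ * A₁ * A₂ * CU * (U a * (U b)⁻¹) *
          (Real.exp (-(ρ₁ * g.dist a y'')) * Real.exp (-((ρ₂ - ε) * g.dist y'' b))) := by
    intro y''
    have hinv := inv_le_of_transfer U hU0 hU y'' b
    rw [hsymm b y''] at hinv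
    have hstep : (U y'')⁻¹ * Real.exp (-(ρ₂ * g.dist y'' b)) ≤
        CU * (U b)⁻¹ * Real.exp (-((ρ₂ - ε) * g.dist y'' b)) := by
      calc (U y'')⁻¹ * Real.exp (-(ρ₂ * g.dist y'' b))
          ≤ CU * Real.exp (ε * g.dist y'' b) * (U b)⁻¹ * Real.exp (-(ρ₂ * g.dist y'' b)) :=
            mul_le_mul_of_nonneg_right hinv (Real.exp_nonneg _)
        _ = CU * (U b)⁻¹ * (Real.exp (ε * g.dist y'' b) * Real.exp (-(ρ₂ * g.dist y'' b))) := by ring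
        _ = CU * (U b)⁻¹ * Real.exp (-((ρ₂ - ε) * g.dist y'' b)) := by
            rw [← Real.exp_add]; ring_nf
    have hc0 : 0 ≤ A₁ * U a * Real.exp (-(ρ₁ * g.dist a y'')) * b₂.κ * A₂ :=
      mul_nonneg (mul_nonneg (mul_nonneg (mul_nonneg hA₁ (hU0 a).le) (Real.exp_nonneg _)) b₂.κ_nonneg) hA₂
    calc A₁ * U a * Real.exp (-(ρ₁ * g.dist a y'')) * (b₂.κ * (A₂ * (U y'')⁻¹ * Real.exp (-(ρ₂ * g.dist y'' b))))
        = A₁ * U a * Real.exp (-(ρ₁ * g.dist a y'')) * b₂.κ * A₂ *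
            ((U y'')⁻¹ * Real.exp (-(ρ₂ * g.dist y'' b))) := by ring
      _ ≤ A₁ * U a * Real.exp (-(ρ₁ * g.dist a y'')) * b₂.κ * A₂ *
            (CU * (U b)⁻¹ * Real.exp (-((ρ₂ - ε) * g.dist y'' b))) := mul_le_mul_of_nonneg_left hstep hc0
      _ = _ := by ring
  have hK0 : 0 ≤ b₂.κ * A₁ * A₂ * CU * (U a * (U b)⁻¹) :=
    mul_nonneg (mul_nonneg (mul_nonneg (mul_nonneg b₂.κ_nonneg hA₁) hA₂) hCU)
      (mul_nonneg (hU0 a).le (inv_nonneg.mpr (hU0 b).le))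
  calc ∑ y'' : g.Site, A₁ * U a * Real.exp (-(ρ₁ * g.dist a y'')) *
        (b₂.κ * (A₂ * (U y'')⁻¹ * Real.exp (-(ρ₂ * g.dist y'' b))))
      ≤ ∑ y'' : g.Site, b₂.κ * A₁ * A₂ * CU * (U a * (U b)⁻¹) *
          (Real.exp (-(ρ₁ * g.dist a y'')) * Real.exp (-((ρ₂ - ε) * g.dist y'' b))) :=
        Finset.sum_le_sum fun y'' _ => hterm y''
    _ = b₂.κ * A₁ * A₂ * CU * (U a * (U b)⁻¹) *
          ∑ y'' : g.Site, Real.exp (-(ρ₁ * g.dist a y'')) * Real.exp (-((ρ₂ - ε) * g.dist y'' b)) := by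
        rw [Finset.mul_sum]
    _ ≤ b₂.κ * A₁ * A₂ * CU * (U a * (U b)⁻¹) * (c * Real.exp (-(ρ * g.dist a b))) :=
        mul_le_mul_of_nonneg_left hconv hK0
    _ = b₂.κ * A₁ * A₂ * CU * c * (U a / U b) * Real.exp (-(ρ * g.dist a b)) := by
        rw [div_eq_mul_inv]; ring

end Comp

/-! ## §3  A U-ratio majorant is a U²-ratio majorant (p. 398 remark) -/

section RatioSq

/-- **Moving one power to the other side** (p. 398: «we may replace the factor (L^jη)^α by (L^jη)^β(L^{j′}η)^γ»): a majorant
`θ·(U y∕U y′)·e^{−ρd}` is a majorant `θ·C_U·(U y∕U y′)²·e^{−(ρ−ε)d}` once U transfers along the distance.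
[cite: Balaban1985BackgroundPropagators, p.398 (remark); Balaban1984PropagatorsII, (2.2) p.224] -/
theorem HasMaj.ratio_sq {b₁ : BlockNorm g F₁} {b₃ : BlockNorm g F₃} {T : F₁ →ₗ[ℝ] F₃} (U : g.Site → ℝ)
    {θ CU ε ρ : ℝ} (hsymm : ∀ a b : g.Site, g.dist a b = g.dist b a) (hθ : 0 ≤ θ) (hU0 : ∀ y, 0 < U y)
    (hU : ∀ x y, U x ≤ CU * Real.exp (ε * g.dist x y) * U y)
    (h : HasMaj b₁ b₃ T (fun a b => θ * (U a / U b) * Real.exp (-(ρ * g.dist a b)))) :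
    HasMaj b₁ b₃ T (fun a b => θ * CU * (U a / U b) ^ 2 * Real.exp (-((ρ - ε) * g.dist a b))) := by
  refine h.mono fun a b => ?_
  have hr := ratio_le_transfer_sq U hU0 hU a b
  rw [hsymm b a] at hr
  calc θ * (U a / U b) * Real.exp (-(ρ * g.dist a b))
      ≤ θ * (CU * Real.exp (ε * g.dist a b) * (U a / U b) ^ 2) * Real.exp (-(ρ * g.dist a b)) :=
        mul_le_mul_of_nonneg_right (mul_le_mul_of_nonneg_left hr hθ) (Real.exp_nonneg _)
    _ = θ * CU * (U a / U b) ^ 2 * (Real.exp (ε * g.dist a b) * Real.exp (-(ρ * g.dist a b))) := by ring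
    _ = θ * CU * (U a / U b) ^ 2 * Real.exp (-((ρ - ε) * g.dist a b)) := by
        rw [← Real.exp_add]; ring_nf

end RatioSq

/-! ## §4  Sect. B assembly: V = G′C₀ + Σ_k (G′∇*_k)C_k in the ratio form with W = (Lʲη)² -/

section SectB

variable {FY : Type} [AddCommGroup FY] [Module ℝ FY]

/-- «A summation preserves it also» ([4] p. 232) over an arbitrary finite index set: if `T_k ≺ K_k` for `k ∈ s` then
`Σ_{k∈s} T_k ≺ Σ_{k∈s} K_k` (`B11SectG.hasMaj_sum` is the `Finset.range` case). [cite: Balaban1984PropagatorsII, (2.52)–(2.55) p.232] -/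
theorem hasMaj_finsetSum {b₁ : BlockNorm g F₁} {b₂ : BlockNorm g F₂} {K : Type} (s : Finset K)
    (T : K → F₁ →ₗ[ℝ] F₂) (Kk : K → g.Site → g.Site → ℝ) (h : ∀ k ∈ s, HasMaj b₁ b₂ (T k) (Kk k)) :
    HasMaj b₁ b₂ (∑ k ∈ s, T k) (fun a c => ∑ k ∈ s, Kk k a c) := by
  classical
  induction s using Finset.induction_on with
  | empty => simpa using hasMaj_zero b₁ b₂
  | insert k s hk ih =>
      have h1 : HasMaj b₁ b₂ (T k) (Kk k) := h k (Finset.mem_insert_self k s)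
      have h2 := ih fun k' hk' => h k' (Finset.mem_insert_of_mem hk')
      have := h1.add h2
      simpa [Finset.sum_insert hk] using this

/-- **THE ZEROTH-ORDER PIECE G′C₀**: G′ with the (3.42)₁∕(3.46)₁-type member `B₀·ℓ(y)²·e^{−ρ₁d}` in the block norm `b`, C₀ with
the (3.61) zeroth-order size `c₀·ℓ(y)⁻²·e^{−ρ₂d}` in `b`, scales transferring as `ℓ(x) ≤ C_ℓ e^{εd(x,y)} ℓ(y)` ⇒
`G′C₀ ≺ κ·B₀·c₀·C_ℓ²·c·(ℓ(y)²∕ℓ(y′)²)·e^{−ρd}` (ρ + 2ε ≤ ρ₂, ρ + σ ≤ ρ₁).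
[cite: Balaban1985BackgroundPropagators, (3.61)–(3.62) p.402 + (3.42) p.397; Balaban1984PropagatorsII, (2.52)–(2.55) p.232] -/
theorem hasMaj_ratio_zeroth {b : BlockNorm g F₁} {G' C₀ : F₁ →ₗ[ℝ] F₁} (ℓ : g.Site → ℝ)
    {B₀ c₀ Cℓ ε ρ₁ ρ₂ ρ σ c : ℝ}
    (htri : Triangle254 g) (hd : ∀ a b : g.Site, 0 ≤ g.dist a b) (hsymm : ∀ a b : g.Site, g.dist a b = g.dist b a)
    (hrow : RowSum g σ c) (hB₀ : 0 ≤ B₀) (hc₀ : 0 ≤ c₀) (hCℓ : 0 ≤ Cℓ) (hℓ0 : ∀ y, 0 < ℓ y)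
    (hℓ : ∀ x y, ℓ x ≤ Cℓ * Real.exp (ε * g.dist x y) * ℓ y)
    (hρ : 0 ≤ ρ) (hρ₂ : ρ + 2 * ε ≤ ρ₂) (hρ₁ : ρ + σ ≤ ρ₁)
    (hG : HasMaj b b G' (fun a y => B₀ * ℓ a ^ 2 * Real.exp (-(ρ₁ * g.dist a y))))
    (hC : HasMaj b b C₀ (fun y b' => c₀ * (ℓ y ^ 2)⁻¹ * Real.exp (-(ρ₂ * g.dist y b')))) :
    HasMaj b b (G' ∘ₗ C₀)
      (fun a b' => b.κ * B₀ * c₀ * Cℓ ^ 2 * c * (ℓ a ^ 2 / ℓ b' ^ 2) * Real.exp (-(ρ * g.dist a b'))) :=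
  hasMaj_comp_ratio (fun y => ℓ y ^ 2) htri hd hsymm hrow hB₀ hc₀ (sq_nonneg Cℓ) (fun y => pow_pos (hℓ0 y) 2)
    (fun x y => transfer_sq ℓ hℓ0 hCℓ hℓ x y) hρ (by linarith) hρ₁ hG hC

/-- **A FIRST-ORDER PIECE (G′∇*_k)C_k**: the (3.42)₃∕(3.46)₃-type member `B₀·ℓ(y)·e^{−ρ₁d}` of G′∇*_k from the bond-space norm
`bY` into `b`, the (3.61)∕(3.73) first-order size `c₁·ℓ(y)⁻¹·e^{−ρ₂d}` of the coefficient C_k from `b` into `bY` ⇒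
`(G′∇*_k)C_k ≺ κ_Y·B₀·c₁·C_ℓ²·c·(ℓ(y)∕ℓ(y′))²·e^{−ρd}` — the single power ℓ(y)∕ℓ(y′) converted to the common weight (Lʲη)² by
the p. 398 remark (ρ + 2ε ≤ ρ₂, ρ + ε + σ ≤ ρ₁).
[cite: Balaban1985BackgroundPropagators, (3.61)–(3.62) p.402 + (3.42) p.397 + p.398 (remark); Balaban1984PropagatorsII, (2.52)–(2.55) p.232] -/
theorem hasMaj_ratio_first {b : BlockNorm g F₁} {bY : BlockNorm g FY} {GD : FY →ₗ[ℝ] F₁} {C₁ : F₁ →ₗ[ℝ] FY}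
    (ℓ : g.Site → ℝ) {B₀ c₁ Cℓ ε ρ₁ ρ₂ ρ σ c : ℝ}
    (htri : Triangle254 g) (hd : ∀ a b : g.Site, 0 ≤ g.dist a b) (hsymm : ∀ a b : g.Site, g.dist a b = g.dist b a)
    (hrow : RowSum g σ c) (hc : 0 ≤ c) (hB₀ : 0 ≤ B₀) (hc₁ : 0 ≤ c₁) (hCℓ : 0 ≤ Cℓ) (hℓ0 : ∀ y, 0 < ℓ y)
    (hℓ : ∀ x y, ℓ x ≤ Cℓ * Real.exp (ε * g.dist x y) * ℓ y)
    (hρ : 0 ≤ ρ) (hε : 0 ≤ ε) (hρ₂ : ρ + 2 * ε ≤ ρ₂) (hρ₁ : ρ + ε + σ ≤ ρ₁)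
    (hG : HasMaj bY b GD (fun a y => B₀ * ℓ a * Real.exp (-(ρ₁ * g.dist a y))))
    (hC : HasMaj b bY C₁ (fun y b' => c₁ * (ℓ y)⁻¹ * Real.exp (-(ρ₂ * g.dist y b')))) :
    HasMaj b b (GD ∘ₗ C₁)
      (fun a b' => bY.κ * B₀ * c₁ * Cℓ * c * Cℓ * (ℓ a / ℓ b') ^ 2 * Real.exp (-(ρ * g.dist a b'))) := by
  have h1 : HasMaj b b (GD ∘ₗ C₁)
      (fun a b' => bY.κ * B₀ * c₁ * Cℓ * c * (ℓ a / ℓ b') * Real.exp (-((ρ + ε) * g.dist a b'))) :=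
    hasMaj_comp_ratio ℓ htri hd hsymm hrow hB₀ hc₁ hCℓ hℓ0 hℓ (by linarith) (by linarith) (by linarith) hG hC
  have h2 := HasMaj.ratio_sq ℓ hsymm
    (mul_nonneg (mul_nonneg (mul_nonneg (mul_nonneg bY.κ_nonneg hB₀) hc₁) hCℓ) hc) hℓ0 hℓ h1
  refine h2.mono fun a b' => le_of_eq ?_
  rw [add_sub_cancel_right]

/-- **SECT. B: THE CONJUGATED MAJORANT OF V = G′(U)V′(A)** — the input `hV` of `B9Thm37AllNormsRight.neumann_left_weighted` with
W = (Lʲη)².  If V = G′C₀ + Σ_{k∈s} (G′∇*_k)C_k (V′(A) in divergence form, any finite index set s of bonds∕directions), G′ and the G′∇*_k have the members `B₀ℓ²e^{−ρ₁d}`,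
`B₀ℓe^{−ρ₁d}` in the block norm `b` (from `b`, resp. from the bond norm `bY`), C₀ and the C_k the (3.61)-sizes `c₀ℓ⁻²e^{−ρ₂d}`,
`c₁ℓ⁻¹e^{−ρ₂d}`, the scales transfer and Lemma 2.1 holds at rate σ, then
`V ≺ θ·(ℓ(y)²∕ℓ(y′)²)·e^{−ρd}`, `θ = B₀·c·C_ℓ²·(κ·c₀ + #s·κ_Y·c₁)` (ρ + 2ε ≤ ρ₂, ρ + ε + σ ≤ ρ₁).  Print: θ = O(α₁B₀) = the
smallness of (3.63)∕(3.86). [cite: Balaban1985BackgroundPropagators, (3.60)–(3.64) p.402 + (3.86) p.408 + p.398 (remark); Balaban1984PropagatorsII, (2.52)–(2.55) p.232 + Lemma 2.1 p.234] -/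
theorem hasMaj_ratio_sectB {b : BlockNorm g F₁} {bY : BlockNorm g FY} {V G' C₀ : F₁ →ₗ[ℝ] F₁} {K : Type}
    (s : Finset K) (GD : K → FY →ₗ[ℝ] F₁) (C₁ : K → F₁ →ₗ[ℝ] FY) (ℓ : g.Site → ℝ)
    {B₀ c₀ c₁ Cℓ ε ρ₁ ρ₂ ρ σ c : ℝ}
    (htri : Triangle254 g) (hd : ∀ a b : g.Site, 0 ≤ g.dist a b) (hsymm : ∀ a b : g.Site, g.dist a b = g.dist b a)
    (hrow : RowSum g σ c) (hc : 0 ≤ c) (hB₀ : 0 ≤ B₀) (hc₀ : 0 ≤ c₀) (hc₁ : 0 ≤ c₁) (hCℓ : 0 ≤ Cℓ)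
    (hℓ0 : ∀ y, 0 < ℓ y) (hℓ : ∀ x y, ℓ x ≤ Cℓ * Real.exp (ε * g.dist x y) * ℓ y)
    (hρ : 0 ≤ ρ) (hε : 0 ≤ ε) (hρ₂ : ρ + 2 * ε ≤ ρ₂) (hρ₁ : ρ + ε + σ ≤ ρ₁)
    (hG : HasMaj b b G' (fun a y => B₀ * ℓ a ^ 2 * Real.exp (-(ρ₁ * g.dist a y))))
    (hC₀ : HasMaj b b C₀ (fun y b' => c₀ * (ℓ y ^ 2)⁻¹ * Real.exp (-(ρ₂ * g.dist y b'))))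
    (hGD : ∀ k ∈ s, HasMaj bY b (GD k) (fun a y => B₀ * ℓ a * Real.exp (-(ρ₁ * g.dist a y))))
    (hC₁ : ∀ k ∈ s, HasMaj b bY (C₁ k) (fun y b' => c₁ * (ℓ y)⁻¹ * Real.exp (-(ρ₂ * g.dist y b'))))
    (hV : V = G' ∘ₗ C₀ + ∑ k ∈ s, GD k ∘ₗ C₁ k) :
    HasMaj b b V (fun a b' => B₀ * c * Cℓ ^ 2 * (b.κ * c₀ + s.card * (bY.κ * c₁)) * (ℓ a ^ 2 / ℓ b' ^ 2) *
      Real.exp (-(ρ * g.dist a b'))) := by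
  have h0 := hasMaj_ratio_zeroth ℓ htri hd hsymm hrow hB₀ hc₀ hCℓ hℓ0 hℓ hρ hρ₂ (by linarith) hG hC₀
  have hpiece : ∀ k ∈ s, HasMaj b b (GD k ∘ₗ C₁ k)
      (fun a b' => bY.κ * B₀ * c₁ * Cℓ * c * Cℓ * (ℓ a / ℓ b') ^ 2 * Real.exp (-(ρ * g.dist a b'))) :=
    fun k hk => hasMaj_ratio_first ℓ htri hd hsymm hrow hc hB₀ hc₁ hCℓ hℓ0 hℓ hρ hε hρ₂ hρ₁ (hGD k hk) (hC₁ k hk)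
  have hsum := hasMaj_finsetSum s (fun k => GD k ∘ₗ C₁ k) _ hpiece
  rw [hV]
  refine (h0.add hsum).mono fun a b' => le_of_eq ?_
  rw [Finset.sum_const, nsmul_eq_mul, div_pow]
  ring

end SectB

/-! ## §5  The sharp-block sup sizes: the same with `B6RandomWalk.HasMajorant` hypotheses (the letters' native vocabulary) -/

section Sup

open B9Thm34Ext

variable {g9 : B9.Geometry} [Fintype g9.Site] {R : ℝ} {H : Prop} {W : Type} [Fintype W]

/-- The cutting constant of the sharp-block sup sizes is 1. [folklore] -/
private theorem ofBlocks_kappa (G : B6.Geometry) {X : Type} [Fintype X] (blk : X → G.Site) :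
    (BlockNorm.ofBlocks G blk).κ = 1 := rfl

/-- **SECT. B, SUP SIZES OF (3.42)**: `hasMaj_ratio_sectB` with every hypothesis a `B6RandomWalk.HasMajorant` at the sharp blocks of
`blk` over the geometry `toB6 g` — the native vocabulary of the lineage's (3.42) members (`B9Thm37Glue*`) and of r06's V′-letters
(`B9Eq360VprimeLetters.hasMajorant_divForm_zeroth_vPrime`: `C″ ≺ c·α₁·(Lʲη)⁻²·e^{−δd}`; `B9Eq352GradLetters.hasMajorant_coefLetter`:
`c′·α₁·(Lʲη)⁻¹·e^{−δd}`) — via `B11SectG.hasMaj_of_hasMajorant` (κ = 1): `V ≺ B₀·c·C_ℓ²·(c₀ + m·c₁)·((Lʲη)²(y)∕(Lʲη)²(y′))·e^{−ρd}`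
between the sharp-block sup sizes, i.e. the `hV` of `neumann_left_weighted` at `b₁ = ofBlocks`.
[cite: Balaban1985BackgroundPropagators, (3.60)–(3.64) p.402 + (3.42) p.397 + p.398 (remark); Balaban1984PropagatorsII, (2.51)–(2.55) p.232 + Lemma 2.1 p.234] -/
theorem hasMaj_ratio_sectB_sup (blk : W → g9.Site) {V G' C₀ : Module.End ℝ (W → ℝ)} {K : Type} (s : Finset K)
    (GD C₁ : K → Module.End ℝ (W → ℝ)) {B₀ c₀ c₁ Cℓ ε ρ₁ ρ₂ ρ σ c : ℝ}
    (htri : Triangle254 (toB6 g9 R H)) (hd : ∀ a b : g9.Site, 0 ≤ g9.dist a b)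
    (hsymm : ∀ a b : g9.Site, g9.dist a b = g9.dist b a) (hrow : RowSum (toB6 g9 R H) σ c) (hc : 0 ≤ c)
    (hB₀ : 0 ≤ B₀) (hc₀ : 0 ≤ c₀) (hc₁ : 0 ≤ c₁) (hCℓ : 0 ≤ Cℓ) (hℓ0 : ∀ y : g9.Site, 0 < g9.len y)
    (hℓ : ∀ x y : g9.Site, g9.len x ≤ Cℓ * Real.exp (ε * g9.dist x y) * g9.len y)
    (hρ : 0 ≤ ρ) (hε : 0 ≤ ε) (hρ₂ : ρ + 2 * ε ≤ ρ₂) (hρ₁ : ρ + ε + σ ≤ ρ₁)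
    (hG : HasMajorant (g := toB6 g9 R H) blk G'
      (fun a y => B₀ * g9.len a ^ 2 * Real.exp (-(ρ₁ * g9.dist a y))))
    (hC₀ : HasMajorant (g := toB6 g9 R H) blk C₀
      (fun y b' => c₀ * (g9.len y ^ 2)⁻¹ * Real.exp (-(ρ₂ * g9.dist y b'))))
    (hGD : ∀ k ∈ s, HasMajorant (g := toB6 g9 R H) blk (GD k)
      (fun a y => B₀ * g9.len a * Real.exp (-(ρ₁ * g9.dist a y))))
    (hC₁ : ∀ k ∈ s, HasMajorant (g := toB6 g9 R H) blk (C₁ k)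
      (fun y b' => c₁ * (g9.len y)⁻¹ * Real.exp (-(ρ₂ * g9.dist y b'))))
    (hV : V = G' ∘ₗ C₀ + ∑ k ∈ s, GD k ∘ₗ C₁ k) :
    HasMaj (BlockNorm.ofBlocks (toB6 g9 R H) blk) (BlockNorm.ofBlocks (toB6 g9 R H) blk) V
      (fun a b' => B₀ * c * Cℓ ^ 2 * (c₀ + s.card * c₁) * (g9.len a ^ 2 / g9.len b' ^ 2) *
        Real.exp (-(ρ * g9.dist a b'))) := by
  have hℓnn : ∀ y : g9.Site, 0 ≤ g9.len y := fun y => (hℓ0 y).le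
  have hG' := hasMaj_of_hasMajorant (g := toB6 g9 R H) blk
    (fun a y => mul_nonneg (mul_nonneg hB₀ (sq_nonneg _)) (Real.exp_nonneg _)) hG
  have hC₀' := hasMaj_of_hasMajorant (g := toB6 g9 R H) blk
    (fun y b' => mul_nonneg (mul_nonneg hc₀ (inv_nonneg.mpr (sq_nonneg _))) (Real.exp_nonneg _)) hC₀
  have hGD' : ∀ k ∈ s, HasMaj (BlockNorm.ofBlocks (toB6 g9 R H) blk) (BlockNorm.ofBlocks (toB6 g9 R H) blk) (GD k)
      (fun a y => B₀ * g9.len a * Real.exp (-(ρ₁ * g9.dist a y))) := fun k hk =>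
    hasMaj_of_hasMajorant (g := toB6 g9 R H) blk
      (fun a y => mul_nonneg (mul_nonneg hB₀ (hℓnn a)) (Real.exp_nonneg _)) (hGD k hk)
  have hC₁' : ∀ k ∈ s, HasMaj (BlockNorm.ofBlocks (toB6 g9 R H) blk) (BlockNorm.ofBlocks (toB6 g9 R H) blk) (C₁ k)
      (fun y b' => c₁ * (g9.len y)⁻¹ * Real.exp (-(ρ₂ * g9.dist y b'))) := fun k hk =>
    hasMaj_of_hasMajorant (g := toB6 g9 R H) blk
      (fun y b' => mul_nonneg (mul_nonneg hc₁ (inv_nonneg.mpr (hℓnn y))) (Real.exp_nonneg _)) (hC₁ k hk)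
  have h := hasMaj_ratio_sectB (g := toB6 g9 R H) s GD C₁ (fun y : g9.Site => g9.len y) htri hd hsymm hrow hc hB₀ hc₀
    hc₁ hCℓ hℓ0 hℓ hρ hε hρ₂ hρ₁ hG' hC₀' hGD' hC₁' hV
  refine h.mono fun a b' => le_of_eq ?_
  rw [ofBlocks_kappa, one_mul, one_mul]
  rfl

end Sup

/-! ## §6  Theorem 3.4's member in the norm `b`: the Neumann series (3.62)–(3.64) summed by `neumann_left_weighted` -/

section Thm34

/-- **SECT. B ∕ THEOREM 3.4, THE (L^jη)²-MEMBER OF G′(U′U) IN AN ARBITRARY BLOCK NORM** («The above inequalities and expansions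
allow us to extend all the estimates of Theorems 3.1–3.3 to the operators G′(U′U) …», pp. 402–403): from the member
`G′(U) ≺ B₀(Lʲη)²e^{−δ₀d}` in `b`, the conjugated majorant `V = G′(U)V′(A) ≺ θ((Lʲη)²(y)∕(Lʲη)²(y′))e^{−δ₀d}` of §4∕§5, the resolvent
identity G′(U′U) = G′(U) + G′(U)V′(A)G′(U′U) ((3.62), `hfix`), an a-priori constant majorant (`hap`), Lemma 2.1 of [4] at α with a
symmetric distance and the smallness κθc₁(α) < 1 ((3.63)∕(3.86): θ = O(α₁B₀)): `G′(U′U) ≺ B₀c₁(α)(1 − κθc₁(α))⁻¹(Lʲη)²e^{−(1−α)δ₀d}`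
— dag-n06-b's `B9Thm37AllNormsRight.neumann_left_weighted` at W = (Lʲη)², Q = 1, BY NAME.
[cite: Balaban1985BackgroundPropagators, Thm 3.4 + (3.60)–(3.64) pp.400–403 + (3.86) p.408; Balaban1984PropagatorsII, Lemma 2.1 (2.61)–(2.63) p.234] -/
theorem thm34_member_of_ratio {b : BlockNorm g F₁} (d : ℕ) {δ₀ α θ B₀ M₀ : ℝ} (ℓ : g.Site → ℝ)
    {G' G₁ : F₁ →ₗ[ℝ] F₁} {V : Module.End ℝ F₁}
    (hB₀ : 0 ≤ B₀) (hℓ0 : ∀ y, 0 < ℓ y) (hθ : 0 ≤ θ) (hM₀ : 0 ≤ M₀) (hαδ : 0 ≤ α * δ₀)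
    (h1αδ : 0 ≤ (1 - α) * δ₀) (htri : Triangle254 g) (hrefl : ∀ y : g.Site, g.dist y y = 0)
    (hdnn : ∀ y y' : g.Site, 0 ≤ g.dist y y') (hsymm : ∀ a c : g.Site, g.dist a c = g.dist c a)
    (h261 : Ineq261 d g δ₀ α) (h263 : Ineq263 d g δ₀ α) (hsmall : b.κ * θ * B6.c1 d δ₀ α < 1)
    (hG : HasMaj b b G' (fun a c => B₀ * ℓ a ^ 2 * Real.exp (-(δ₀ * g.dist a c))))
    (hV : HasMaj b b V (fun a c => θ * (ℓ a ^ 2 / ℓ c ^ 2) * Real.exp (-(δ₀ * g.dist a c))))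
    (hfix : G₁ = G' + V ∘ₗ G₁) (hap : HasMaj b b G₁ (fun _ _ => M₀)) :
    HasMaj b b G₁ (fun a c => B₀ * B6.c1 d δ₀ α * (1 - b.κ * θ * B6.c1 d δ₀ α)⁻¹ * ℓ a ^ 2 *
      Real.exp (-((1 - α) * δ₀ * g.dist a c))) := by
  have hS : HasMaj b b G' (fun a c => B₀ * (ℓ a ^ 2) * (1 : ℝ) * Real.exp (-(δ₀ * g.dist a c))) :=
    hG.mono fun a c => by rw [mul_one]
  have h := B9Thm37AllNormsRight.neumann_left_weighted b b d δ₀ α θ B₀ M₀ (fun y => ℓ y ^ 2) (fun _ => (1 : ℝ))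
    hB₀ (fun y => pow_pos (hℓ0 y) 2) (fun _ => zero_le_one) hθ hM₀ hαδ h1αδ htri hrefl hdnn hsymm h261 h263 hsmall
    hS hV hfix hap
  refine h.mono fun a c => le_of_eq ?_
  rw [mul_one]

end Thm34

end

end Literature.MathematicalPhysics.QuantumFieldTheory.Balaban1983to89.B9SectBRatioComp
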